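import Literature.NumberTheory.PAdicHodge.BmaxPlusBdRModFil
import Literature.NumberTheory.PAdicHodge.BdRPlusLogTypeSeries
import Literature.RingTheory.FormalGroups.PadicLogTypeSeries
import HarnessLib

/-!
# The comparison `B_max⁺ → B_dR⁺/Fil^k` on series of logarithmic type: `Λᵇ_N(y) ↦ p^N · ℓ_b(y)`

Topic `Literature/NumberTheory/PAdicHodge`; namespace `Literature.NumberTheory.PAdicHodge`. THEOREMS ONLY (no definition, no named
fact, no instance, no `sorry`). Sequel of `BmaxPlusBdRModFil` (the comparison `exists_bdR_lim_modFil`) — brick B5b of the φ-road of line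
`kato_lever` (crux K★ `stmt-BirchSwinnertonDyer-22226`, memo `Cruxes/StarredOptimalManinUnitFiveSeven/Lines/kato-lever-K2-phi-road.md` §1):
the IDENTIFICATION of the two `p`-adic evaluations of a series of logarithmic type `ℓ_b(y) = Σ_{m≥1} (b_m/m) yᵐ` (`b : ℕ → ℤ_p`, e.g. a
formal-group logarithm) at `y = y₀ ∈ 𝔸_inf` `p`-nilpotent in `B⁰_max` (`y₀^N = p·z`):
the `A_max`-valued `Λ = PadicLogSeries.logSum ι b N y₀ z ∈ B_max⁺` (`= p^N·ℓ_b(y₀)`, generic file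
`Literature/RingTheory/FormalGroups/PadicLogTypeSeries.lean`, where Frobenius acts) and the `B_dR⁺/Fil^k`-valued `IsLogTypeModFil b k y₀ L`
(`BdRPlusLogTypeSeries`, where the explicit reciprocity law is read).

* `algebraMap_coe_term`, `algebraMap_coe_partialSum` — **`ι₀(T_m) = p^N · (b_m/m) ι(y₀)^m`** and `ι₀(S_M) = p^N · P^b_M(y₀)` in `B_dR⁺`
  (`m·T_m = ι(b_m) p^N y₀^m`, `m` a unit of `B_dR⁺`);
* ★★ `exists_isLogTypeModFil_of_bdR_lim_modFil_logSum` — if `L ∈ B_dR⁺` is a limit of `Λ` modulo `Fil^k` (`exists_bdR_lim_modFil`), then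
  `L = p^N · L'` with **`IsLogTypeModFil b k y₀ L'`**: the comparison carries `Λᵇ_N(y₀)` to `p^N·ℓ_b(y₀)`;
* ★ `exists_isLogTypeModFil_of_pow_eq` — hence `ℓ_b(y₀)` HAS a value modulo every `Fil^k` for every `p`-NILPOTENT `y₀` (e.g. lifts of
  deep division points, `y₀^N ∈ (p, ξ)`), extending `exists_isLogTypeModFil` (which needs `y₀ ∈ (p, ξ)`);
* ★ `sub_mem_span_xiBdR_pow_of_bdR_lim_modFil_logSum` — and any limit `L` of `Λ` satisfies `L ≡ p^N·L'' (mod ξ^k)` for EVERY value `L''`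
  of `ℓ_b(y₀)` modulo `Fil^k` (uniqueness).

Infrastructure only: BSD / K★ are not proved by any of this.

## References
* [Colmez1992PeriodesAbeliennes] P. Colmez, *Périodes p-adiques des variétés abéliennes*, Math. Ann. 292 (1992), §2.
* [Colmez1998Annals] P. Colmez, *Théorie d'Iwasawa des représentations de de Rham d'un corps local*, Ann. of Math. 148 (1998), §III.2.
* [FontaineAsterisque223III] J.-M. Fontaine, *Le corps des périodes p-adiques*, Astérisque 223 (1994), Exp. II §1.5.3–1.5.4.
-/

noncomputable section

open WittVector Field ValuativeRel Finset
open Literature.AlgebraicGeometry.Resolution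
open Literature.RingTheory.FormalGroups

namespace Literature.NumberTheory.PAdicHodge

open Literature.NumberTheory.GaloisRepresentations
open Literature.NumberTheory.GaloisRepresentations.IsNonarchimedeanLocalField
open GaloisContinuity

variable {F : Type} [Field F] [ValuativeRel F] [TopologicalSpace F] [IsNonarchimedeanLocalField F]
  [CharZero F] {p : ℕ} [Fact p.Prime] [Fact (¬ IsUnit (p : integerC F))]
  [IsAdicComplete (Ideal.span {(p : integerC F)}) (integerC F)]

omit [CharZero F] in
/-- `ι₀` as the ring map `(𝔸_inf[1/p] → B_dR⁺) ∘ val`. [folklore: unfolding] -/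
private theorem comp_val_apply₄ (y : bmaxZero F p) :
    ((algebraMap (Localization.Away (p : Ainf (p := p) F)) (BDeRhamPlus (integerC F) p)).comp (bmaxZero F p).val.toRingHom) y =
      algebraMap (Localization.Away (p : Ainf (p := p) F)) (BDeRhamPlus (integerC F) p) (y : Localization.Away (p : Ainf (p := p) F)) := rfl

omit [CharZero F] in
/-- `ι₀ ∘ (𝔸_inf → B⁰_max) = ι : 𝔸_inf → B_dR⁺`. [folklore: unfolding of the structure maps] -/
private theorem algebraMap_coe_algebraMap₄ (a : Ainf (p := p) F) :
    algebraMap (Localization.Away (p : Ainf (p := p) F)) (BDeRhamPlus (integerC F) p)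
        ((algebraMap (Ainf (p := p) F) (bmaxZero F p) a : bmaxZero F p) : Localization.Away (p : Ainf (p := p) F)) =
      ainfToBdR a := rfl

/-! ### §1 Terms and partial sums under `ι₀` -/

set_option maxHeartbeats 400000 in
omit [CharZero F] in
/-- **`ι₀(T_m) = p^N · (b_m/m)·ι(y₀)^m`** (`m ≥ 1`): the `m`-th term of `Λᵇ_N(y₀, z)` maps to `p^N` times the `m`-th term of `ℓ_b(y₀)` in
`B_dR⁺` (`m·T_m = ι(b_m)·p^N·y₀^m` and `m` is a unit of `B_dR⁺`). [cite: Colmez1992PeriodesAbeliennes, §2] [cite: Colmez1998Annals, §III.2] -/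
theorem algebraMap_coe_term (b : ℕ → ℤ_[p]) {N : ℕ} (hN : 1 ≤ N) (y₀ : Ainf (p := p) F) {z : bmaxZero F p}
    (hz : algebraMap (Ainf (p := p) F) (bmaxZero F p) y₀ ^ N = (p : bmaxZero F p) * z) {m : ℕ} (hm : m ≠ 0) :
    algebraMap (Localization.Away (p : Ainf (p := p) F)) (BDeRhamPlus (integerC F) p)
        ((PadicLogSeries.term ((algebraMap (Ainf (p := p) F) (bmaxZero F p)).comp zpToAinf) b N
          (algebraMap (Ainf (p := p) F) (bmaxZero F p) y₀) z m : bmaxZero F p) : Localization.Away (p : Ainf (p := p) F)) =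
      (p : BDeRhamPlus (integerC F) p) ^ N * logTypeTerm b y₀ m := by
  have h := PadicLogSeries.natCast_mul_term ((algebraMap (Ainf (p := p) F) (bmaxZero F p)).comp zpToAinf) b hN hz hm
  have h1 := congrArg ((algebraMap (Localization.Away (p : Ainf (p := p) F)) (BDeRhamPlus (integerC F) p)).comp
    (bmaxZero F p).val.toRingHom) h
  rw [map_mul, map_natCast, map_mul, map_mul, map_pow, map_pow, map_natCast, comp_val_apply₄, comp_val_apply₄, RingHom.comp_apply,
    comp_val_apply₄, algebraMap_coe_algebraMap₄, algebraMap_coe_algebraMap₄, ← qpToBdR_coe] at h1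
  -- `m · (p^N · logTypeTerm) = qpToBdR(b_m) · p^N · ι(y₀)^m`
  have hm' : (m : ℚ_[p]) ≠ 0 := Nat.cast_ne_zero.2 hm
  have h2 : (m : BDeRhamPlus (integerC F) p) * ((p : BDeRhamPlus (integerC F) p) ^ N * logTypeTerm b y₀ m) =
      qpToBdR ((b m : ℤ_[p]) : ℚ_[p]) * (p : BDeRhamPlus (integerC F) p) ^ N * ainfToBdR y₀ ^ m := by
    rw [logTypeTerm, ← map_natCast (qpToBdR (F := F) (p := p)) m]
    have e : (qpToBdR (m : ℚ_[p]) : BDeRhamPlus (integerC F) p) * qpToBdR (((b m : ℤ_[p]) : ℚ_[p]) / (m : ℚ_[p])) =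
        qpToBdR ((b m : ℤ_[p]) : ℚ_[p]) := by
      rw [← map_mul, mul_div_cancel₀ _ hm']
    linear_combination ((p : BDeRhamPlus (integerC F) p) ^ N * ainfToBdR y₀ ^ m) * e
  exact (isUnit_natCast_bDeRhamPlus (F := F) (p := p) hm).mul_left_cancel (h1.trans h2.symm)

omit [CharZero F] in
/-- **`ι₀(S_M) = p^N · P^b_M(y₀)`**: partial sums correspond. [cite: Colmez1992PeriodesAbeliennes, §2] [cite: Colmez1998Annals, §III.2] -/
theorem algebraMap_coe_partialSum (b : ℕ → ℤ_[p]) {N : ℕ} (hN : 1 ≤ N) (y₀ : Ainf (p := p) F) {z : bmaxZero F p}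
    (hz : algebraMap (Ainf (p := p) F) (bmaxZero F p) y₀ ^ N = (p : bmaxZero F p) * z) (M : ℕ) :
    algebraMap (Localization.Away (p : Ainf (p := p) F)) (BDeRhamPlus (integerC F) p)
        ((PadicLogSeries.partialSum ((algebraMap (Ainf (p := p) F) (bmaxZero F p)).comp zpToAinf) b N
          (algebraMap (Ainf (p := p) F) (bmaxZero F p) y₀) z M : bmaxZero F p) : Localization.Away (p : Ainf (p := p) F)) =
      (p : BDeRhamPlus (integerC F) p) ^ N * logTypePartialSum b y₀ M := by
  rw [PadicLogSeries.partialSum, logTypePartialSum, ← comp_val_apply₄, map_sum, mul_sum]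
  refine sum_congr rfl fun m _ => ?_
  rw [comp_val_apply₄, algebraMap_coe_term b hN y₀ hz (Nat.succ_ne_zero m)]

/-! ### §2 The comparison carries `Λᵇ_N(y₀)` to `p^N · ℓ_b(y₀)` -/

set_option maxHeartbeats 3200000 in
omit [CharZero F] in
/-- ★★ **The comparison `B_max⁺ → B_dR⁺/Fil^k` sends `Λᵇ_N(y₀, z)` to `p^N·ℓ_b(y₀)`**: if `L ∈ B_dR⁺` is a limit of
`Λ = PadicLogSeries.logSum ι b N y₀ z` modulo `Fil^k` (in the sense of `exists_bdR_lim_modFil`, any shift `r`), then `L = p^N · L'` with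
`IsLogTypeModFil b k y₀ L'` — the partial sums `S_M`, `M ≥ 2nN`, represent `Λ mod pⁿ`, and `ι₀(S_M) = p^N·P^b_M(y₀)`.
[cite: Colmez1998Annals, §III.2] [cite: FontaineAsterisque223III, Exp. II §1.5.3–1.5.4] -/
theorem exists_isLogTypeModFil_of_bdR_lim_modFil_logSum (b : ℕ → ℤ_[p]) {N : ℕ} (hN : 1 ≤ N) (y₀ : Ainf (p := p) F)
    {z : bmaxZero F p} (hz : algebraMap (Ainf (p := p) F) (bmaxZero F p) y₀ ^ N = (p : bmaxZero F p) * z)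
    {k : ℕ} {L : BDeRhamPlus (integerC F) p} {r : ℕ}
    (h : ∀ N' M : ℕ, N' + r ≤ M → ∀ y : bmaxZero F p,
      AdicCompletion.evalₐ (Ideal.span {(p : bmaxZero F p)}) M
          (PadicLogSeries.logSum ((algebraMap (Ainf (p := p) F) (bmaxZero F p)).comp zpToAinf) b N
            (algebraMap (Ainf (p := p) F) (bmaxZero F p) y₀) z) = Ideal.Quotient.mk _ y →
      ∃ (a : Ainf (p := p) F) (w : BDeRhamPlus (integerC F) p),
        (p : BDeRhamPlus (integerC F) p) ^ k *
            (L - algebraMap (Localization.Away (p : Ainf (p := p) F)) (BDeRhamPlus (integerC F) p)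
              (y : Localization.Away (p : Ainf (p := p) F))) =
          ainfToBdR ((p : Ainf (p := p) F) ^ N' * a) + xiBdR ^ k * w) :
    ∃ L' : BDeRhamPlus (integerC F) p, (p : BDeRhamPlus (integerC F) p) ^ N * L' = L ∧ IsLogTypeModFil b k y₀ L' := by
  -- `p^{k+N}` is a unit of `B_dR⁺`
  obtain ⟨v, hv⟩ := (isUnit_natCast_bDeRhamPlus (F := F) (p := p) (Fact.out : p.Prime).ne_zero).pow (k + N)
  set vi : BDeRhamPlus (integerC F) p := ((v⁻¹ : (BDeRhamPlus (integerC F) p)ˣ) : BDeRhamPlus (integerC F) p) with hvi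
  have hvinv : (p : BDeRhamPlus (integerC F) p) ^ (k + N) * vi = 1 := by rw [hvi, ← hv, Units.mul_inv]
  refine ⟨vi * (p : BDeRhamPlus (integerC F) p) ^ k * L, ?_, fun j => ⟨2 * (j + k + N + r) * N, fun M hM => ?_⟩⟩
  · have e : (p : BDeRhamPlus (integerC F) p) ^ N * (vi * (p : BDeRhamPlus (integerC F) p) ^ k * L) =
        ((p : BDeRhamPlus (integerC F) p) ^ (k + N) * vi) * L := by rw [pow_add]; ring
    rw [e, hvinv, one_mul]
  -- the partial sum `S_M` represents `Λ` at level `n = j + k + N + r`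
  have hrep := PadicLogSeries.evalₐ_logSum_of_le ((algebraMap (Ainf (p := p) F) (bmaxZero F p)).comp zpToAinf) b
    (algebraMap (Ainf (p := p) F) (bmaxZero F p) y₀) z hN (n := j + k + N + r) (M := M) hM
  obtain ⟨a, w, e⟩ := h (j + k + N) (j + k + N + r) le_rfl _ hrep
  rw [algebraMap_coe_partialSum b hN y₀ hz] at e
  refine ⟨a, vi * w, ?_⟩
  -- multiply `e` by `vi` and use `p^{k+N}·vi = 1`
  have e2 : vi * ((p : BDeRhamPlus (integerC F) p) ^ k * (L - (p : BDeRhamPlus (integerC F) p) ^ N * logTypePartialSum b y₀ M)) =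
      vi * (ainfToBdR ((p : Ainf (p := p) F) ^ (j + k + N) * a) + xiBdR ^ k * w) := by rw [e]
  simp only [map_mul, map_pow, map_natCast, pow_add] at e2 hvinv ⊢
  linear_combination e2 + (logTypePartialSum b y₀ M + (p : BDeRhamPlus (integerC F) p) ^ j * ainfToBdR a) * hvinv

/-- ★ **Values of `ℓ_b(y₀)` modulo `Fil^k` exist for every `p`-NILPOTENT `y₀`** (`y₀^N = p·z` in `B⁰_max`, e.g. `y₀^N ∈ (p, ξ)`,
`exists_algebraMap_pow_eq_natCast_mul`): from the `B_max⁺`-valued sum and the comparison. (For `y₀ ∈ (p, ξ)` this is `exists_isLogTypeModFil`.)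
[cite: Colmez1992PeriodesAbeliennes, §2] [cite: FontaineAsterisque223III, Exp. II §1.5.3–1.5.4] -/
theorem exists_isLogTypeModFil_of_pow_eq (b : ℕ → ℤ_[p]) {N : ℕ} (hN : 1 ≤ N) (y₀ : Ainf (p := p) F)
    {z : bmaxZero F p} (hz : algebraMap (Ainf (p := p) F) (bmaxZero F p) y₀ ^ N = (p : bmaxZero F p) * z) (k : ℕ) :
    ∃ L' : BDeRhamPlus (integerC F) p, IsLogTypeModFil b k y₀ L' := by
  obtain ⟨L, r, h⟩ := exists_bdR_lim_modFil (PadicLogSeries.logSum ((algebraMap (Ainf (p := p) F) (bmaxZero F p)).comp zpToAinf) b N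
    (algebraMap (Ainf (p := p) F) (bmaxZero F p) y₀) z) k
  obtain ⟨L', -, hL'⟩ := exists_isLogTypeModFil_of_bdR_lim_modFil_logSum b hN y₀ hz h
  exact ⟨L', hL'⟩

/-- ★ **Identification**: a limit `L` of `Λᵇ_N(y₀, z)` modulo `Fil^k` and ANY value `L''` of `ℓ_b(y₀)` modulo `Fil^k` satisfy
`L ≡ p^N · L'' (mod ξ^k B_dR⁺)`. [cite: Colmez1998Annals, §III.2] [cite: FontaineAsterisque223III, Exp. II §1.5.3] -/
theorem sub_mem_span_xiBdR_pow_of_bdR_lim_modFil_logSum (b : ℕ → ℤ_[p]) {N : ℕ} (hN : 1 ≤ N) (y₀ : Ainf (p := p) F)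
    {z : bmaxZero F p} (hz : algebraMap (Ainf (p := p) F) (bmaxZero F p) y₀ ^ N = (p : bmaxZero F p) * z)
    {k : ℕ} {L : BDeRhamPlus (integerC F) p} {r : ℕ}
    (h : ∀ N' M : ℕ, N' + r ≤ M → ∀ y : bmaxZero F p,
      AdicCompletion.evalₐ (Ideal.span {(p : bmaxZero F p)}) M
          (PadicLogSeries.logSum ((algebraMap (Ainf (p := p) F) (bmaxZero F p)).comp zpToAinf) b N
            (algebraMap (Ainf (p := p) F) (bmaxZero F p) y₀) z) = Ideal.Quotient.mk _ y →
      ∃ (a : Ainf (p := p) F) (w : BDeRhamPlus (integerC F) p),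
        (p : BDeRhamPlus (integerC F) p) ^ k *
            (L - algebraMap (Localization.Away (p : Ainf (p := p) F)) (BDeRhamPlus (integerC F) p)
              (y : Localization.Away (p : Ainf (p := p) F))) =
          ainfToBdR ((p : Ainf (p := p) F) ^ N' * a) + xiBdR ^ k * w)
    {L'' : BDeRhamPlus (integerC F) p} (hL'' : IsLogTypeModFil b k y₀ L'') :
    L - (p : BDeRhamPlus (integerC F) p) ^ N * L'' ∈ Ideal.span {(xiBdR : BDeRhamPlus (integerC F) p) ^ k} := by
  obtain ⟨L', hL, hL'⟩ := exists_isLogTypeModFil_of_bdR_lim_modFil_logSum b hN y₀ hz h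
  rw [← hL, ← mul_sub]
  exact Ideal.mul_mem_left _ _ (hL'.sub_mem_span_xiBdR_pow hL'')

end Literature.NumberTheory.PAdicHodge

end
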